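import Summits.SmoothPoincare4.SmoothPoincare4.Theorems.CylinderEntropyImmortalAreaToFloorShadowInjective
import Summits.SmoothPoincare4.SmoothPoincare4.Theorems.CylinderEntropyImmortalAreaToFloorParameters
import Summits.SmoothPoincare4.SmoothPoincare4.Theorems.CylinderEntropyImmortalAreaToFloorCounting
import Summits.SmoothPoincare4.SmoothPoincare4.Theorems.CylinderEntropyImmortalAreaToFloorGoodSet
import Summits.SmoothPoincare4.SmoothPoincare4.Theorems.CylinderEntropyImmortalAreaToFloorFlowInputs
import Summits.SmoothPoincare4.SmoothPoincare4.Theorems.CylinderEntropyImmortalAreaToFloorReduction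
import Summits.SmoothPoincare4.SmoothPoincare4.Theorems.CylinderEntropyCylinderRungTwoHeightsConverge
import Summits.SmoothPoincare4.SmoothPoincare4.Theorems.CylinderEntropyCylinderRungTwoTiltExcess
import Summits.SmoothPoincare4.SmoothPoincare4.Theses.CylinderEntropy
import HarnessLib

/-!
# Route `CylinderEntropy`, item `ImmortalAreaToFloor` (stmt-SmoothPoincare4-17197): THE PROOF
# (module Γ8 of `BLUEPRINT-17197-c2.md`, assembly)

**Theorem (`areaToFloor`, the registered stub shape; `ImmortalAreaToFloor_proof`, the item verbatim).**
Along every immortal smooth mean curvature flow `(F t)_{t ≥ T}` of compact connected embedded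
cross-sections of `N = S⁴ × ℝ ⊂ ℝ⁶` whose slices separate the ends of `N` and have cylinder entropy
`λ_cyl < 2`: for every `ε > 0` some slice has `μH⁴(F_t(M)) ≤ (1+ε) μH⁴(S⁴)`.

Proof (Allard-free; by contradiction, all slices having area `> (1+ε) vol`).  Fix the universal
constants (Besicovitch `N`, cutoff constants `c₁, c₂`), the flow constants (uniform upper Gaussian
density `2 - δ₀` at late times for scales `≤ τ_max` — entropy `< 2` and Hamilton's monotonicity;
Ahlfors growth `C_A, R₀`; height bound `B`; initial area `A_tot`), and the stacking parameters
(`exists_stackingParameters`, tilt threshold `ξ ≤ ε/4`).  At a late time `r` with heights within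
`g_max/2` of a constant (`helper_heightsConverge`) and Willmore energy `∫ H² ≤ W₁`
(`exists_late_smallWillmore`; hence tilt excess `∫ |ν'|² ≤ B √(A W)` small), take the GOOD SET `G`
of the slice (`exists_goodSet`): its complement has area `≤ (N+1)E/ξ + N W/θ ≤ κ₄ vol ε/4`, its shadow
is injective (`shadow_injOn_of_good` = no two good points on one vertical, the stacking contradiction)
and `|ν₅| ≥ 1 - ξ` on it, so the multiplicity area formula gives `(1-ξ) μ(G) ≤ κ₄ vol`
(`ofReal_mul_riemannianMeasure_le_of_injOn_shadow`).  Hence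
`κ₄ μH⁴(F_r M) = μ(M) ≤ κ₄ vol (1 + 2ξ) + κ₄ vol ε/4 < κ₄ (1+ε) vol`, a contradiction.

References: W. K. Allard, Ann. of Math. 95 (1972) §6; R. S. Hamilton, Comm. Anal. Geom. 1 (1993);
T. H. Colding, W. P. Minicozzi II, Ann. of Math. 175 (2012).
-/

-- the prescribed namespace `Summit.SmoothPoincare4.SmoothPoincare4.…` repeats `SmoothPoincare4`
set_option linter.dupNamespace false

noncomputable section

open Bundle Set Function Filter MeasureTheory Module
open scoped Manifold ContDiff Topology RealInnerProductSpace BigOperators ENNReal NNReal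

namespace Summit.SmoothPoincare4.SmoothPoincare4.Cruxes.CylinderRungTwo.KillingFlux

open Literature.Geometry.Riemannian Literature.Geometry.Riemannian.EuclideanHypersurface
open Literature.Geometry.Lorentzian Literature.Geometry.Lorentzian.PseudoRiemannianMetric
open Literature.Geometry.Riemannian.SphericalCylinderEntropy (cylEntropy cylDensity truncL truncL_apply
  hausdorffMeasure_sphere_four_pos hausdorffMeasure_sphere_four_lt_top)
open Summit.SmoothPoincare4.SmoothPoincare4.Theorems.GoodPoints (exists_goodSet)

/-! ### Real-arithmetic book-keeping of the final contradiction -/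

/-- The tilt budget: `E ≤ B √(A W) ≤ e₀` once `W ≤ (e₀/(|B|+1))²/(A_tot+1)`, `A ≤ A_tot`. [folklore] -/
theorem tilt_budget {E B A Atot W e₀ : ℝ} (hE : E ≤ B * Real.sqrt (A * W)) (hA0 : 0 ≤ A) (hA : A ≤ Atot)
    (hW0 : 0 ≤ W) (hW : W ≤ (e₀ / (|B| + 1)) ^ 2 / (Atot + 1)) (he₀ : 0 ≤ e₀) : E ≤ e₀ := by
  have hAtot : 0 ≤ Atot := hA0.trans hA
  have hBp : 0 < |B| + 1 := by positivity
  have h1 : A * W ≤ (e₀ / (|B| + 1)) ^ 2 := by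
    calc A * W ≤ (Atot + 1) * W := mul_le_mul_of_nonneg_right (by linarith) hW0
      _ ≤ (Atot + 1) * ((e₀ / (|B| + 1)) ^ 2 / (Atot + 1)) := mul_le_mul_of_nonneg_left hW (by linarith)
      _ = (e₀ / (|B| + 1)) ^ 2 := by field_simp
  have h2 : Real.sqrt (A * W) ≤ e₀ / (|B| + 1) := by
    calc Real.sqrt (A * W) ≤ Real.sqrt ((e₀ / (|B| + 1)) ^ 2) := Real.sqrt_le_sqrt h1
      _ = e₀ / (|B| + 1) := Real.sqrt_sq (by positivity)
  have h3 : B * Real.sqrt (A * W) ≤ (|B| + 1) * (e₀ / (|B| + 1)) := by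
    calc B * Real.sqrt (A * W) ≤ |B| * Real.sqrt (A * W) :=
          mul_le_mul_of_nonneg_right (le_abs_self B) (Real.sqrt_nonneg _)
      _ ≤ (|B| + 1) * Real.sqrt (A * W) := mul_le_mul_of_nonneg_right (by linarith) (Real.sqrt_nonneg _)
      _ ≤ (|B| + 1) * (e₀ / (|B| + 1)) := mul_le_mul_of_nonneg_left h2 hBp.le
  have h4 : (|B| + 1) * (e₀ / (|B| + 1)) = e₀ := by field_simp
  linarith

/-- The final contradiction of the areas. [folklore] -/
theorem area_contradiction {κr v ε ξ Ar μu μG μGc b₁ b₂ : ℝ} (hκ : 0 < κr) (hv : 0 < v)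
    (hξ0 : 0 < ξ) (hξε : ξ ≤ ε / 4) (hξh : ξ ≤ 1 / 2) (hcon : (1 + ε) * v < Ar) (hμu : μu = κr * Ar)
    (hsplit : μu ≤ μG + μGc) (hG : (1 - ξ) * μG ≤ κr * v) (hGc : μGc ≤ b₁ + b₂)
    (hb₁ : b₁ ≤ κr * v * ε / 8) (hb₂ : b₂ ≤ κr * v * ε / 8) : False := by
  have hkv : 0 < κr * v := mul_pos hκ hv
  -- `μG ≤ κr v (1 + 2ξ)`
  have hμG : μG ≤ κr * v * (1 + 2 * ξ) := by
    have h1 : 0 < 1 - ξ := by linarith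
    have h2 : κr * v ≤ κr * v * ((1 - ξ) * (1 + 2 * ξ)) := by
      have : (1 : ℝ) ≤ (1 - ξ) * (1 + 2 * ξ) := by nlinarith
      nlinarith
    -- `(1-ξ) μG ≤ (1-ξ) (κr v (1+2ξ))`
    have h3 : (1 - ξ) * μG ≤ (1 - ξ) * (κr * v * (1 + 2 * ξ)) := by nlinarith
    exact le_of_mul_le_mul_left h3 h1
  have hAr : κr * ((1 + ε) * v) < κr * Ar := mul_lt_mul_of_pos_left hcon hκ
  nlinarith

/-- On a unit vector of `ℝ⁶` with small horizontal part the vertical component is almost `±1`: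
`∑_{i<5} νᵢ² ≤ ξ ≤ 1` and `‖ν‖ = 1` give `1 - ξ ≤ |ν₅|`. [folklore] -/
theorem one_sub_le_abs_apply_five {v : EuclideanSpace ℝ (Fin 6)} (hv : ‖v‖ = 1) {ξ : ℝ} (hξ1 : ξ ≤ 1)
    (hS : ∑ i : Fin 5, v (Fin.castSucc i) ^ 2 ≤ ξ) : 1 - ξ ≤ |v 5| := by
  have h := norm_sq_eq_sum_castSucc_add_sq v
  rw [hv, one_pow] at h
  have h5 : 1 - ξ ≤ v 5 ^ 2 := by linarith
  have h0 : 0 ≤ 1 - ξ := by linarith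
  have hξ0 : 0 ≤ ξ := le_trans (Finset.sum_nonneg fun i _ => sq_nonneg _) hS
  have hsq : (1 - ξ) ^ 2 ≤ |v 5| ^ 2 := by
    rw [sq_abs]
    calc (1 - ξ) ^ 2 ≤ (1 - ξ) * 1 := by rw [sq]; exact mul_le_mul_of_nonneg_left (by linarith) h0
      _ = 1 - ξ := mul_one _
      _ ≤ v 5 ^ 2 := h5
  exact (pow_le_pow_iff_left₀ h0 (abs_nonneg _) two_ne_zero).1 hsq

/-! ### The theorem -/

/-- **AREA TO THE FLOOR ALONG IMMORTAL THIN CYLINDER FLOWS** (registered stub shape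
`stub_areaToFloor` of line `killing-flux`; item `ImmortalAreaToFloor`, stmt-SmoothPoincare4-17197, in
the folded vocabulary).  See the module docstring for the statement and the proof.
[cite: Allard1972, §6] -/
theorem areaToFloor : ∀ (M : Type) [TopologicalSpace M] [T2Space M] [SecondCountableTopology M]
    [ChartedSpace (EuclideanSpace ℝ (Fin 4)) M] [IsManifold (𝓡 4) ∞ M] [CompactSpace M] [ConnectedSpace M]
    (F : ℝ → M → EuclideanSpace ℝ (Fin 6)) (ν : ℝ → M → EuclideanSpace ℝ (Fin 6)) (T : ℝ),
    IsCylinderMCF M F ν T →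
    (∀ t, T ≤ t → SeparatesEnds (Set.range (F t))) →
    (∀ t, T ≤ t → cylEntropy (Set.range (F t)) < 2) →
    ∀ ε : ℝ, 0 < ε → ∃ t : ℝ, T ≤ t ∧
      μH[4] (Set.range (F t)) ≤ ENNReal.ofReal (1 + ε) * μH[4] (Metric.sphere (0 : EuclideanSpace ℝ (Fin 5)) 1) := by
  intro M _ _ _ _ _ _ _ F ν T hF hsep hthin ε hε
  by_contra hcon
  push Not at hcon
  letI : MeasurableSpace M := borel M
  haveI : BorelSpace M := ⟨rfl⟩
  -- `M` is non-empty
  rcases isEmpty_or_nonempty M with hM | hM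
  · haveI := hM
    have h := hcon T le_rfl
    rw [Set.range_eq_empty (F T), measure_empty] at h
    exact ENNReal.not_lt_zero h
  -- the volume of the slice and the normalising constant
  have hvol0 := (hausdorffMeasure_sphere_four_pos).ne'
  have hvoltop := (hausdorffMeasure_sphere_four_lt_top).ne
  obtain ⟨v, hvdef⟩ : ∃ v : ℝ, v = (μH[4] (Metric.sphere (0 : EuclideanSpace ℝ (Fin 5)) 1)).toReal := ⟨_, rfl⟩
  have hv : 0 < v := by rw [hvdef]; exact ENNReal.toReal_pos hvol0 hvoltop
  set κ₄ : ℝ≥0 := Measure.addHaarScalarFactor (volume : Measure (EuclideanSpace ℝ (Fin 4)))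
    (μH[(4 : ℕ)] : Measure (EuclideanSpace ℝ (Fin 4))) with hκ₄
  have hκ0 : κ₄ ≠ 0 := Measure.addHaarScalarFactor_volume_hausdorffMeasure_ne_zero 4
  have hκr : 0 < (κ₄ : ℝ) := NNReal.coe_pos.2 (pos_iff_ne_zero.2 hκ0)
  -- universal constants
  obtain ⟨Nb, hNb⟩ := exists_goodSet
  obtain ⟨c₁, c₂, hc₁, hc₂, hcut⟩ := exists_heightCutoff
  -- flow constants
  obtain ⟨δ₀, hδ₀, hδ₀h, τmax, hτmax, s₀, hs₀T, hup⟩ := upperGaussianDensity_late hF hsep hthin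
  obtain ⟨CA, hCA, R₀, hR₀, hAhl⟩ := ahlforsGrowth_of_thin
  obtain ⟨B, hB⟩ := hF.exists_height_bound
  obtain ⟨Atot, hAtotdef⟩ : ∃ A : ℝ, A = ((μHE[4] : Measure (EuclideanSpace ℝ (Fin 6))) (Set.range (F T))).toReal :=
    ⟨_, rfl⟩
  have hAtot0 : 0 ≤ Atot := by rw [hAtotdef]; exact ENNReal.toReal_nonneg
  obtain ⟨CG, hCGdef⟩ : ∃ CG : ℝ, CG = 2048 * Real.exp (1 / 16) * CA / Real.pi ^ 2 + Atot / R₀ ^ 4 := ⟨_, rfl⟩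
  have hCG0 : 0 ≤ CG := by rw [hCGdef]; positivity
  -- the stacking parameters, with tilt threshold `ξ ≤ ε/4`
  obtain ⟨η, Λ₁, C₀sq, Kρ, κ, ξ, θ, W₀, gmax, hη, -, hC₀, hKρ, hκ, hξ, hξε, hξh, hθ, hW₀, hgmax, hpar⟩ :=
    exists_stackingParameters hδ₀ (by linarith) hτmax hR₀ hCA hCG0 hc₁.le hc₂.le (by positivity : (0 : ℝ) < ε / 4)
  -- lateness: heights within `gmax/2` of a constant
  obtain ⟨ch, hch⟩ := helper_heightsConverge M F ν T hF hthin
  obtain ⟨sh, hshT, hheight⟩ := hch (gmax / 2) (by positivity)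
  -- lateness: small Willmore energy
  obtain ⟨e₀, he₀def⟩ : ∃ e : ℝ, e = ξ * ((κ₄ : ℝ) * v * ε) / (8 * ((Nb : ℝ) + 1)) := ⟨_, rfl⟩
  have he₀ : 0 < e₀ := by rw [he₀def]; positivity
  obtain ⟨W₁, hW₁def⟩ : ∃ W : ℝ, W = min W₀ (min (θ * ((κ₄ : ℝ) * v * ε) / (8 * ((Nb : ℝ) + 1)))
    ((e₀ / (|B| + 1)) ^ 2 / (Atot + 1))) := ⟨_, rfl⟩
  have hW₁ : 0 < W₁ := by rw [hW₁def]; positivity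
  have hW₁a : W₁ ≤ W₀ := by rw [hW₁def]; exact min_le_left _ _
  have hW₁b : W₁ ≤ θ * ((κ₄ : ℝ) * v * ε) / (8 * ((Nb : ℝ) + 1)) := by
    rw [hW₁def]; exact (min_le_right _ _).trans (min_le_left _ _)
  have hW₁c : W₁ ≤ (e₀ / (|B| + 1)) ^ 2 / (Atot + 1) := by
    rw [hW₁def]; exact (min_le_right _ _).trans (min_le_right _ _)
  obtain ⟨r, hrT, hr₁, hWr⟩ := exists_late_smallWillmore hF hW₁ (s₁ := max (max s₀ sh) T) (le_max_right _ _)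
  have hrs₀ : s₀ ≤ r := (le_max_left _ _).trans ((le_max_left _ _).trans hr₁)
  have hrsh : sh ≤ r := (le_max_right _ _).trans ((le_max_left _ _).trans hr₁)
  -- the slice at time `r`
  have hf := hF.isSpacelikeImmersion r hrT
  have hemb := hF.isSmoothEmbedding r hrT
  have hν := hF.contMDiff_normal r hrT
  have hun := hF.isUnitNormal r hrT
  have hN := hF.mem_cyl r hrT
  have hνN := hF.normal_tangent r hrT
  set g₁ := (euclideanMetric (EuclideanSpace ℝ (Fin 6))).inducedRiemannianMetric (F r)
    contMDiff_pullbackBilin_holds hf with hg₁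
  set μ := riemannianMeasure g₁ with hμ
  haveI : IsFiniteMeasure μ := isFiniteMeasure_riemannianMeasure g₁
  set Hm : M → ℝ := fun w => (euclideanMetric (EuclideanSpace ℝ (Fin 6))).meanCurvature (F r)
    contMDiff_pullbackBilin_holds hf (ν r) w with hHm
  set S : M → ℝ := fun w => ∑ i : Fin 5, ν r w (Fin.castSucc i) ^ 2 with hS
  have hfc : Continuous (F r) := hf.contMDiff_self.continuous
  have hνc : Continuous (ν r) := hν.continuous
  have hHc : Continuous Hm := continuous_meanCurvature_euclidean hf hν
  have hSc : Continuous S := by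
    refine continuous_finsetSum _ fun i _ => ?_
    exact ((EuclideanSpace.proj (Fin.castSucc i) : EuclideanSpace ℝ (Fin 6) →L[ℝ] ℝ).continuous.comp hνc).pow 2
  have hS0 : ∀ w, 0 ≤ S w := fun w => Finset.sum_nonneg fun i _ => sq_nonneg _
  have hSi : Integrable S μ := integrable_of_continuous (h := g₁) hSc
  have hHi : Integrable (fun w => Hm w ^ 2) μ := integrable_of_continuous (h := g₁) (hHc.pow 2)
  have hνunit : ∀ w, ‖ν r w‖ = 1 := fun w => norm_eq_one_of_isUnitNormal hun w
  have hS1 : ∀ w, S w = 1 - ν r w 5 ^ 2 := fun w => by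
    have h := norm_sq_eq_sum_castSucc_add_sq (ν r w)
    rw [hνunit w, one_pow] at h
    simp only [hS]; linarith
  -- Willmore and tilt at time `r`
  have hWW : ∫ w, Hm w ^ 2 ∂μ ≤ W₁ := hWr
  have hW0 : 0 ≤ ∫ w, Hm w ^ 2 ∂μ := integral_nonneg fun w => sq_nonneg _
  have hμuniv : μ Set.univ = (κ₄ : ℝ≥0∞) * μH[4] (Set.range (F r)) := hF.riemannianMeasure_univ_eq_smul hrT
  have hμreal : μ.real Set.univ ≤ Atot := by rw [hAtotdef]; exact hF.riemannianMeasure_real_univ_le_initial hrT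
  have hE : ∫ w, S w ∂μ ≤ e₀ := by
    have h1 : ∫ w, S w ∂μ = ∫ w, (1 - ν r w 5 ^ 2) ∂μ := integral_congr_ae (Eventually.of_forall hS1)
    have h2 := tiltExcess_le_sqrt_of_abs_height_le hf hν hun hN hνN (hB r hrT)
    rw [h1]
    refine tilt_budget h2 measureReal_nonneg ?_ hW0 (hWW.trans hW₁c) he₀.le
    simpa [measureReal_def] using hμreal
  -- the good set
  obtain ⟨G, hGm, hGpt, hGtilt, hGH, hGbad⟩ := hNb M μ (F r) hfc S (fun w => Hm w ^ 2) hSc (hHc.pow 2) hS0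
    (fun w => sq_nonneg _) hSi hHi ξ θ R₀ hξ hθ
  -- the height gap at time `r`
  have hgap : ∀ x x' : M, F r x' 5 - F r x 5 ≤ gmax := fun x x' => by
    have h1 := hheight r hrsh x
    have h2 := hheight r hrsh x'
    rw [abs_lt] at h1 h2
    linarith
  -- the shadow is injective on the good set
  have hinj : InjOn (fun x => truncL (F r x)) G :=
    shadow_injOn_of_good hf hemb hν hun hN hνN hδ₀ (by linarith) hR₀ hCA hξ hθ hη hC₀ hKρ hκ hcut
      (hAhl M F ν T hF r hrT (hthin r hrT)) hμreal (by rw [hCGdef]) (hWW.trans hW₁a) (hup r hrT hrs₀)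
      hgap hpar (fun y hy r' hr' hr'R => ⟨hGtilt y hy r' hr' hr'R, hGH y hy r' hr' hr'R⟩)
  -- the vertical angle on the good set
  have hGpt' : ∀ w ∈ G, 1 - ξ ≤ |ν r w 5| := fun w hw =>
    one_sub_le_abs_apply_five (hνunit w) (by linarith) (hGpt w hw)
  -- counting
  haveI : Nonempty M := hM
  have hcount := ofReal_mul_riemannianMeasure_le_of_injOn_shadow hemb hf hN hνc hun hνN hGm
    (by linarith : 0 < 1 - ξ) hGpt' hinj
  -- pass to real numbers
  have hVE : (μHE[4] : Measure (EuclideanSpace ℝ (Fin 5))) (Metric.sphere (0 : EuclideanSpace ℝ (Fin 5)) 1) =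
      (κ₄ : ℝ≥0∞) * μH[4] (Metric.sphere (0 : EuclideanSpace ℝ (Fin 5)) 1) := by
    rw [Measure.euclideanHausdorffMeasure_def, Measure.smul_apply, ENNReal.smul_def, smul_eq_mul]
    rfl
  have hArtop : μH[4] (Set.range (F r)) ≠ ⊤ :=
    (Literature.Geometry.Riemannian.SphericalCylinderEntropy.hausdorffMeasure_range_lt_top_of_isSpacelikeImmersion
      hf (hF.injective hrT)).ne
  -- (a) the contradiction hypothesis
  have hconr : (1 + ε) * v < (μH[4] (Set.range (F r))).toReal := by
    have h := ENNReal.toReal_strict_mono hArtop (hcon r hrT)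
    rwa [ENNReal.toReal_mul, ENNReal.toReal_ofReal (by linarith), ← hvdef] at h
  -- (b) total area
  have hμu : μ.real Set.univ = (κ₄ : ℝ) * (μH[4] (Set.range (F r))).toReal := by
    rw [measureReal_def, hμuniv, ENNReal.toReal_mul, ENNReal.coe_toReal]
  -- (c) splitting
  have hsplit : μ.real Set.univ ≤ μ.real G + μ.real Gᶜ := by
    rw [← Set.union_compl_self G]
    exact measureReal_union_le _ _
  -- (d) the good part
  have hG : (1 - ξ) * μ.real G ≤ (κ₄ : ℝ) * v := by
    rw [hVE] at hcount
    have htop : (κ₄ : ℝ≥0∞) * μH[4] (Metric.sphere (0 : EuclideanSpace ℝ (Fin 5)) 1) ≠ ⊤ :=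
      ENNReal.mul_ne_top ENNReal.coe_ne_top hvoltop
    have h := ENNReal.toReal_mono htop hcount
    rwa [ENNReal.toReal_mul, ENNReal.toReal_ofReal (by linarith), ENNReal.toReal_mul, ENNReal.coe_toReal,
      ← hvdef, ← measureReal_def] at h
  -- (e) the bad part
  have hb₁ : ((Nb : ℝ) + 1) * ((∫ w, S w ∂μ) / ξ) ≤ (κ₄ : ℝ) * v * ε / 8 := by
    have h1 : ((Nb : ℝ) + 1) * ((∫ w, S w ∂μ) / ξ) ≤ ((Nb : ℝ) + 1) * (e₀ / ξ) :=
      mul_le_mul_of_nonneg_left (div_le_div_of_nonneg_right hE hξ.le) (by positivity)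
    have h2 : ((Nb : ℝ) + 1) * (e₀ / ξ) = (κ₄ : ℝ) * v * ε / 8 := by
      rw [he₀def]; field_simp
    linarith
  have hb₂ : (Nb : ℝ) * ((∫ w, Hm w ^ 2 ∂μ) / θ) ≤ (κ₄ : ℝ) * v * ε / 8 := by
    have h1 : (Nb : ℝ) * ((∫ w, Hm w ^ 2 ∂μ) / θ) ≤ (Nb : ℝ) * (W₁ / θ) :=
      mul_le_mul_of_nonneg_left (div_le_div_of_nonneg_right hWW hθ.le) (Nat.cast_nonneg _)
    have h2 : (Nb : ℝ) * (W₁ / θ) ≤ (Nb : ℝ) * ((θ * ((κ₄ : ℝ) * v * ε) / (8 * ((Nb : ℝ) + 1))) / θ) :=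
      mul_le_mul_of_nonneg_left (div_le_div_of_nonneg_right hW₁b hθ.le) (Nat.cast_nonneg _)
    have h3 : (Nb : ℝ) * ((θ * ((κ₄ : ℝ) * v * ε) / (8 * ((Nb : ℝ) + 1))) / θ) =
        (Nb : ℝ) / ((Nb : ℝ) + 1) * ((κ₄ : ℝ) * v * ε / 8) := by
      field_simp
    have h4 : (Nb : ℝ) / ((Nb : ℝ) + 1) ≤ 1 := by
      rw [div_le_one (by positivity)]; linarith
    have h5 : (Nb : ℝ) / ((Nb : ℝ) + 1) * ((κ₄ : ℝ) * v * ε / 8) ≤ 1 * ((κ₄ : ℝ) * v * ε / 8) :=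
      mul_le_mul_of_nonneg_right h4 (by positivity)
    linarith
  exact area_contradiction hκr hv hξ hξε hξh hconr hμu hsplit hG hGbad hb₁ hb₂

end Summit.SmoothPoincare4.SmoothPoincare4.Cruxes.CylinderRungTwo.KillingFlux

namespace Summit.SmoothPoincare4.SmoothPoincare4.Theorems

/-- **Item `ImmortalAreaToFloor` (stmt-SmoothPoincare4-17197), verbatim**: the unfolded route-item
form, from `areaToFloor` through the landed pure-logic glue `immortalAreaToFloor_of_stubShape`.
[cite: Allard1972, §6] -/
theorem ImmortalAreaToFloor_proof : (haveI : (Literature.Geometry.Riemannian.euclideanMetric (EuclideanSpace ℝ (Fin 6))).HasLeviCivita := Literature.Geometry.Riemannian.instHasLeviCivitaEuclideanMetric; ∀ (M : Type) [TopologicalSpace M] [T2Space M] [SecondCountableTopology M] [ChartedSpace (EuclideanSpace ℝ (Fin 4)) M] [IsManifold (𝓡 4) ∞ M] [CompactSpace M] [ConnectedSpace M] (F : ℝ → M → EuclideanSpace ℝ (Fin 6)) (ν : ℝ → M → EuclideanSpace ℝ (Fin 6)) (T : ℝ), (∃ U : Set ℝ, IsOpen U ∧ Set.Ici T ⊆ U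 ∧ ContMDiffOn (𝓘(ℝ, ℝ).prod (𝓡 4)) (𝓡 6) ∞ (fun q : ℝ × M => F q.1 q.2) (U ×ˢ Set.univ)) → (∀ t, T ≤ t → Manifold.IsSmoothEmbedding (𝓡 4) (𝓡 6) ∞ (F t)) → (∀ t, T ≤ t → ∀ x, ∑ i : Fin 5, F t x (Fin.castSucc i) ^ 2 = 1) → ∀ himm : (∀ t, T ≤ t → (Literature.Geometry.Riemannian.euclideanMetric (EuclideanSpace ℝ (Fin 6))).IsSpacelikeImmersion (𝓡 4) (F t)), (∀ t, T ≤ t → (Literature.Geometry.Riemannian.euclideanMetric (EuclideanSpace ℝ (Fin 6))).IsUnitNormal (𝓡 4) (F t) (ν t) 1) → (∀ t, T ≤ t → ∀ x, ∑ i : Fin 5, ν t x (Fin.castSucc i) * F t x (Fin.castSucc i) = 0) → (∀ t, T ≤ t → ContMDiff (𝓡 4) (𝓡 6) ∞ (ν t)) → (∀ t (ht : T ≤ t) (x : M), mfderiv 𝓘(ℝ, ℝ) (𝓡 6) (fun s => F s x) t (1 : ℝ) = -((Literature.Geometry.Riemannian.euclideanMetric (EuclideanSpace ℝ (Fin 6))).meanCurvature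 (F t) Literature.Geometry.Lorentzian.PseudoRiemannianMetric.contMDiff_pullbackBilin_holds (himm t ht) (ν t) x) • ν t x) → (∀ t, T ≤ t → (∃ R : ℝ, ∀ a b : EuclideanSpace ℝ (Fin 6), ∑ i : Fin 5, a (Fin.castSucc i) ^ 2 = 1 → ∑ i : Fin 5, b (Fin.castSucc i) ^ 2 = 1 → a 5 ≤ -R → R ≤ b 5 → ¬ JoinedIn ({z : EuclideanSpace ℝ (Fin 6) | ∑ i : Fin 5, z (Fin.castSucc i) ^ 2 = 1} \ Set.range (F t)) a b)) → (∀ t, T ≤ t → (⨆ (p : EuclideanSpace ℝ (Fin 6)) (_ : ∑ i : Fin 5, p (Fin.castSucc i) ^ 2 = 1) (τ : ℝ) (_ : 0 < τ), (μH[4] (Metric.sphere (0 : EuclideanSpace ℝ (Fin 5)) 1))⁻¹ * ∫⁻ z in Set.range (F t), ENNReal.ofReal ((∑' k : ℕ, Real.exp (-((k : ℝ) * ((k : ℝ) + 3)) * τ) * ((2 * (k : ℝ) + 3) / 3) * ∑ l ∈ Finset.range (k / 2 + 1), (-1 : ℝ) ^ l * (∏ j ∈ Finset.range (k - l), ((3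 : ℝ) / 2 + (j : ℝ))) / (((l.factorial : ℕ) : ℝ) * (((k - 2 * l).factorial : ℕ) : ℝ)) * (2 * ∑ i : Fin 5, z (Fin.castSucc i) * p (Fin.castSucc i)) ^ (k - 2 * l)) * Real.exp (-((z 5 - p 5) ^ 2) / (4 * τ))) ∂μH[4]) < 2) → ∀ ε : ℝ, 0 < ε → ∃ t : ℝ, T ≤ t ∧ μH[4] (Set.range (F t)) ≤ ENNReal.ofReal (1 + ε) * μH[4] (Metric.sphere (0 : EuclideanSpace ℝ (Fin 5)) 1)) :=
  immortalAreaToFloor_of_stubShape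
    Summit.SmoothPoincare4.SmoothPoincare4.Cruxes.CylinderRungTwo.KillingFlux.areaToFloor

end Summit.SmoothPoincare4.SmoothPoincare4.Theorems

end

-- Top-level `open`s kept in effect to the end of the file, so that statement probes appended by the
-- gate (the item's signature uses the `μH[·]`, `∫⁻`, `𝓡`, `𝓘`, `∞` notations) elaborate.
open MeasureTheory
open scoped Manifold ContDiff ENNReal NNReal BigOperators Topology MeasureTheory

namespace Summit.SmoothPoincare4.SmoothPoincare4.Theorems

/-- **Item `ImmortalAreaToFloor` (stmt-SmoothPoincare4-17197) against the route decl** (rendered in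
`Theses/CylinderEntropy.lean` at route rev 5): the route's `def ImmortalAreaToFloor : Prop` is the
item's signature verbatim, and `ImmortalAreaToFloor_proof` proves it. [cite: Allard1972, §6] -/
theorem CylinderEntropy_ImmortalAreaToFloor_proof :
    Summit.SmoothPoincare4.SmoothPoincare4.Theses.CylinderEntropy.ImmortalAreaToFloor :=
  ImmortalAreaToFloor_proof

end Summit.SmoothPoincare4.SmoothPoincare4.Theorems
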